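import Summits.Ventures.Crystal3D.Theorems.StickyWulffConstantTextureLiminfTexShadowLevelReachBornChainsBarlow
import HarnessLib

/-!
# Chain bottoms of FALLING families step into the window (the top-plate twin of …LevelReachBornChainsBarlow; general-sign abstract count)
# (lane T, crux `TextureLiminfV5`, stmt-Ventures-23912, registered stub `stub_terraceCensus`; (β) assembly RESUME (d′) «born supply», geometric boundary half)

HONEST FRAMING. Venture `Summits/Ventures/Crystal3D` (cell `crystal3d-full`), route `route-Ventures-StickyWulffConstant`, helper `--supports` the law-v5
crux `TextureLiminfV5` (stmt-Ventures-23912), lane T, mechanism (β).  Census-free, certificate-free; lane F's clamped-cell lemmas (`sealing_above_barlow`,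
`topBand₂_deep`, 19481-p2's `frame_of_face_receivingPlateBall`) by name; nothing about energies; F-C1 not moved.

THE POINT.  For a FALLING born family (`c = A w`, `c₂ < 0`) the backward chains `p, p − c, p − 2c, …` climb; the launches the census
(`bornMoving_barlow_endPairs_top`, p753554) counts are the chain bottoms whose first step `b + c` lies in the height window.  This file gives
* the abstract count for either sign of `c₂` — `exists_chain_bottom_of_ne`, `card_trackable_le_mul_card_goodBottoms_of_ne` (`hi − lo < K·|c₂|`);
* `not_face_in_topBand` — a ball of `X` in the top seal band `[h+(R₀+1)+1, h+(R₀+1)+2]` within lateral radius `ρ−3` is a deep top-plate ball and carries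
  no face of a frame `A` whose dozen is neither top-plate dozen;
* `chain_heights_lt_top` — climbing chains of `A`-trackable balls from an inner ball `p` (`p₂ < h+(R₀+1)+1`, `√(p₀²+p₁²) + (h+(R₀+1)+2 − p₂)/|c₂| ≤ ρ−3`)
  stay strictly below `h+(R₀+1)+1`;
* **`card_trackable_inner_le_mul_card_launches_top`** — `#R ≤ K · #{b ∈ X : Tr b ∧ ¬Tr (b − c) ∧ −(R₀+1)−1 < (b + c)₂ < h+(R₀+1)+1}` for every finite set
  `R` of inner `A`-trackable balls (`−(R₀+1) < p₂`) — the falling census's launch count for the canonical launch set.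
WHAT THIS IS NOT: the count of trackable balls (lamella geometry), any certificate; F-C1 not moved.
-/

noncomputable section

namespace Summit.Ventures.Crystal3D.Theorems

open Summit.Ventures.Crystal3D Finset
open Literature.MathematicalPhysics.StatisticalMechanics (barlowPos barlowStacking IsHaggSeq barlowPos_mem basalMirror)
open Summit.Ventures.Crystal3D.Cruxes.TextureLiminf.TexShadow (E3 stacking)
open scoped InnerProductSpace

/-! ### The abstract count for either sign of the climb -/

section GoodNe

variable {X : Finset E3} (Tr G : E3 → Prop) (c : E3)

/-- `k ↦ p − k•c` is injective when `c₂ ≠ 0`. -/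
theorem sub_natSmul_injective_of_ne (hc : c 2 ≠ 0) (p : E3) : Function.Injective fun k : ℕ => p - (k : ℝ) • c := by
  intro k k' h
  have h2 := congrArg (fun v : E3 => v 2) h
  simp only [PiLp.sub_apply, PiLp.smul_apply, smul_eq_mul] at h2
  have : (k : ℝ) = (k' : ℝ) := mul_right_cancel₀ hc (by linarith : (k : ℝ) * c 2 = (k' : ℝ) * c 2)
  exact_mod_cast this

/-- **Chain bottoms exist** (either sign of `c₂`). -/
theorem exists_chain_bottom_of_ne (hTrX : ∀ q, Tr q → q ∈ X) (hc : c 2 ≠ 0) {p : E3} (hp : Tr p) :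
    ∃ k : ℕ, (∀ j : ℕ, j ≤ k → Tr (p - (j : ℝ) • c)) ∧ ¬ Tr (p - ((k : ℝ) + 1) • c) := by
  classical
  have hex : ∃ k : ℕ, ¬ Tr (p - (k : ℝ) • c) := by
    by_contra hall
    push Not at hall
    have hsub : (Finset.range (X.card + 1)).image (fun k : ℕ => p - (k : ℝ) • c) ⊆ X := by
      intro q hq
      obtain ⟨k, -, rfl⟩ := mem_image.1 hq
      exact hTrX _ (hall k)
    have hcard := card_le_card hsub
    rw [card_image_of_injective _ (sub_natSmul_injective_of_ne c hc p), card_range] at hcard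
    omega
  set k₀ := Nat.find hex with hk₀
  have hk₀spec : ¬ Tr (p - (k₀ : ℝ) • c) := Nat.find_spec hex
  have hk₀pos : k₀ ≠ 0 := by
    intro h0
    rw [h0, Nat.cast_zero, zero_smul, sub_zero] at hk₀spec
    exact hk₀spec hp
  obtain ⟨k, hk⟩ := Nat.exists_eq_succ_of_ne_zero hk₀pos
  refine ⟨k, fun j hj => ?_, ?_⟩
  · have hlt : j < k₀ := by rw [hk]; omega
    have := Nat.find_min hex hlt
    simpa using this
  · have e : ((k : ℝ) + 1) = ((k₀ : ℕ) : ℝ) := by rw [hk]; push_cast; ring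
    rw [e]; exact hk₀spec

/-- **Trackable balls against good bottoms** (either sign of `c₂`: heights of `X` in `[lo, hi]`, `hi − lo < K·|c₂|`). -/
theorem card_trackable_le_mul_card_goodBottoms_of_ne [DecidablePred Tr] [DecidablePred G] (hTrX : ∀ q, Tr q → q ∈ X) (hc : c 2 ≠ 0)
    {lo hi : ℝ} (hXwin : ∀ q ∈ X, lo ≤ q 2 ∧ q 2 ≤ hi) (K : ℕ) (hK : hi - lo < K * |c 2|)
    (R : Finset E3) (hR : ∀ p ∈ R, Tr p)
    (hgood : ∀ p ∈ R, ∀ k : ℕ, (∀ j : ℕ, j ≤ k → Tr (p - (j : ℝ) • c)) → ¬ Tr (p - ((k : ℝ) + 1) • c) → G (p - (k : ℝ) • c)) :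
    R.card ≤ K * (X.filter fun b => Tr b ∧ ¬ Tr (b - c) ∧ G b).card := by
  classical
  set Bot := X.filter (fun b => Tr b ∧ ¬ Tr (b - c) ∧ G b) with hBot
  have hcover : R ⊆ Bot.biUnion fun b => (Finset.range K).image fun k : ℕ => b + (k : ℝ) • c := by
    intro p hp
    obtain ⟨k, hchain, hstop⟩ := exists_chain_bottom_of_ne Tr c hTrX hc (hR p hp)
    set b : E3 := p - (k : ℝ) • c with hb
    have hTb : Tr b := hchain k le_rfl
    have hbc : b - c = p - ((k : ℝ) + 1) • c := by rw [hb, add_smul, one_smul, sub_sub]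
    have hnot : ¬ Tr (b - c) := by rw [hbc]; exact hstop
    have hGb : G b := hgood p hp k hchain hstop
    have hbX : b ∈ X := hTrX b hTb
    have hpX : p ∈ X := hTrX p (hR p hp)
    have hk2 : p 2 - b 2 = (k : ℝ) * c 2 := by
      rw [hb, PiLp.sub_apply, PiLp.smul_apply, smul_eq_mul]; ring
    have hkK : k < K := by
      have h1 := hXwin p hpX
      have h2 := hXwin b hbX
      have habs : (k : ℝ) * |c 2| ≤ hi - lo := by
        rcases le_or_gt 0 (c 2) with hpos | hneg
        · rw [abs_of_nonneg hpos]; linarith [h1.2, h2.1]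
        · rw [abs_of_neg hneg]; linarith [h1.1, h2.2]
      have h3 : (k : ℝ) * |c 2| < (K : ℝ) * |c 2| := by linarith
      exact_mod_cast lt_of_mul_lt_mul_right h3 (abs_nonneg _)
    refine mem_biUnion.2 ⟨b, mem_filter.2 ⟨hbX, hTb, hnot, hGb⟩, mem_image.2 ⟨k, mem_range.2 hkK, ?_⟩⟩
    show b + (k : ℝ) • c = p
    rw [hb, sub_add_cancel]
  calc R.card ≤ (Bot.biUnion fun b => (Finset.range K).image fun k : ℕ => b + (k : ℝ) • c).card := card_le_card hcover
    _ ≤ ∑ b ∈ Bot, ((Finset.range K).image fun k : ℕ => b + (k : ℝ) • c).card := card_biUnion_le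
    _ ≤ ∑ _b ∈ Bot, K := sum_le_sum fun b _ => card_image_le.trans (card_range K).le
    _ = K * Bot.card := by rw [sum_const, smul_eq_mul, mul_comm]

end GoodNe

/-! ### The clamped cell, top plate: no mover faces in the top seal band; climbing chains stay in the window -/

section CellTop

variable (ver : WordVersion) {σ₂ : ℤ → ℤ} (hσ₂ : IsHaggSeq σ₂) (L₂ : E3 ≃ₗᵢ[ℝ] E3) (s₂ : E3)
  (A : E3 ≃ₗᵢ[ℝ] E3)
  (hneA₁ : (A : E3 → E3) '' ↑fccSlots ≠ (L₂ : E3 → E3) '' ↑fccSlots)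
  (hneA₂ : (A : E3 → E3) '' ↑fccSlots ≠ ((basalMirror.trans L₂ : E3 ≃ₗᵢ[ℝ] E3) : E3 → E3) '' ↑fccSlots)
  {w : E3} (hw : w ∈ fccSlots) (hdown : (A w) 2 < 0)
  (X P₂ : Finset E3) (R₀ h ρ : ℝ) (hR₀ : 5 ≤ R₀) (hρ : R₀ + 2 ≤ ρ)
  (hX : ∀ p ∈ X, ∀ q ∈ X, p ≠ q → 1 ≤ dist p q) (hP₂X : P₂ ⊆ X)
  (hP₂ : ∀ p, p ∈ P₂ ↔ (p ∈ stacking L₂ s₂ σ₂ ∧ h + R₀ ≤ p 2 ∧ p 2 ≤ h + 2 * R₀ ∧ p 0 ^ 2 + p 1 ^ 2 ≤ ρ ^ 2))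
include hσ₂ hneA₁ hneA₂ hw hdown hR₀ hρ hX hP₂X hP₂

omit hw hdown in
/-- **No `A`-face in the top seal band.** -/
theorem not_face_in_topBand {q : E3} (hq : q ∈ X) (h1 : h + (R₀ + 1) + 1 ≤ q 2) (h2 : q 2 ≤ h + (R₀ + 1) + 1 + 1)
    (h3 : q 0 ^ 2 + q 1 ^ 2 ≤ (ρ - 1 - 2) ^ 2) :
    ¬ (∃ a ∈ fccSlots, ∃ a' ∈ fccSlots, ∃ a'' ∈ fccSlots,
        ⟪a, a'⟫_ℝ = 1 / 2 ∧ ⟪a, a''⟫_ℝ = 1 / 2 ∧ ⟪a', a''⟫_ℝ = 1 / 2 ∧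
        q + A a ∈ X ∧ q + A a' ∈ X ∧ q + A a'' ∈ X) := by
  intro hface
  set W₂ : Set E3 := {x : E3 | h + R₀ ≤ x 2 ∧ x 2 ≤ h + 2 * R₀ ∧ x 0 ^ 2 + x 1 ^ 2 ≤ ρ ^ 2} with hW₂
  have hplate₂ : ∀ p ∈ stacking L₂ s₂ σ₂, p ∈ W₂ → p ∈ X := plate_mem_of_clamp₂ L₂ s₂ hP₂X hP₂
  have hseal := sealing_above_barlow L₂ s₂ hX hP₂X hP₂ (R₀ := R₀) (h := h) (ρ := ρ) (by linarith) (by linarith)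
  have hqT := hseal q hq h1 h2 h3
  obtain ⟨k, i, j, rfl, hW⟩ := topBand₂_deep L₂ s₂ hP₂ hR₀ (by linarith) _ hqT
  obtain ⟨a, ha, a', ha', a'', ha'', i1, i2, i3, e1, e2, e3⟩ := hface
  rcases frame_of_face_receivingPlateBall hσ₂ L₂ s₂ hX hplate₂ k i j hW A ha ha' ha'' i1 i2 i3 e1 e2 e3 with h' | h'
  · exact hneA₁ h'
  · exact hneA₂ h'

/-- **Climbing chains of inner trackable balls stay below the window top.** -/
theorem chain_heights_lt_top (Tr : E3 → Prop)
    (hTr : ∀ q, Tr q → q ∈ X ∧ (IsFull X A q ∨ (∃ m, IsTwinReading X A m q ∧ ⟪A w, m⟫_ℝ = 0) ∨ (ver = WordVersion.v2 ∧ IsNarrow X A (A w) q)))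
    {p : E3} (hp2 : p 2 < h + (R₀ + 1) + 1)
    (hlat : Real.sqrt (p 0 ^ 2 + p 1 ^ 2) + (h + (R₀ + 1) + 2 - p 2) / |(A w) 2| ≤ ρ - 1 - 2)
    {k : ℕ} (hchain : ∀ j : ℕ, j ≤ k → Tr (p - (j : ℝ) • A w)) :
    ∀ j : ℕ, j ≤ k → (p - (j : ℝ) • A w) 2 < h + (R₀ + 1) + 1 := by
  have hc1 : ‖A w‖ = 1 := by rw [LinearIsometryEquiv.norm_map, norm_eq_one_of_mem_fccSlots hw]
  have hc2ge : -1 ≤ (A w) 2 := by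
    have := abs_sub_apply_le_dist' (A w) 0 2
    rw [PiLp.zero_apply, sub_zero, dist_zero_right, hc1] at this
    exact (abs_le.1 this).1
  have habs : |(A w) 2| = -(A w) 2 := abs_of_neg hdown
  have habspos : 0 < |(A w) 2| := abs_pos.2 hdown.ne
  intro j
  induction j with
  | zero => intro _; simpa using hp2
  | succ j ih =>
    intro hjk
    have hprev := ih (Nat.le_of_succ_le hjk)
    by_contra hge
    push Not at hge
    set q : E3 := p - ((j + 1 : ℕ) : ℝ) • A w with hq
    have hTq : Tr q := hchain (j + 1) hjk
    obtain ⟨hqX, hmv⟩ := hTr q hTq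
    have hq2 : q 2 = p 2 - ((j : ℝ) + 1) * (A w) 2 := by
      rw [hq, PiLp.sub_apply, PiLp.smul_apply, smul_eq_mul]; push_cast; ring
    have hprev2 : (p - (j : ℝ) • A w) 2 = p 2 - (j : ℝ) * (A w) 2 := by
      rw [PiLp.sub_apply, PiLp.smul_apply, smul_eq_mul]
    rw [hprev2] at hprev
    have h1 : h + (R₀ + 1) + 1 ≤ q 2 := hge
    have h2 : q 2 ≤ h + (R₀ + 1) + 1 + 1 := by rw [hq2]; nlinarith
    -- lateral radius: `dist q p = j+1 ≤ (h + R₀ + 3 − p₂)/|c₂|`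
    have hsteps : ((j : ℝ) + 1) * |(A w) 2| ≤ h + (R₀ + 1) + 2 - p 2 := by rw [habs]; rw [hq2] at h2; linarith
    have hsteps' : (j : ℝ) + 1 ≤ (h + (R₀ + 1) + 2 - p 2) / |(A w) 2| := by rw [le_div_iff₀ habspos]; exact hsteps
    have hdist : dist q p = (j : ℝ) + 1 := by
      rw [hq, dist_eq_norm, sub_sub_cancel_left, norm_neg, norm_smul, hc1, mul_one, Real.norm_eq_abs]
      push_cast
      exact abs_of_nonneg (by positivity)
    have hlatq : Real.sqrt (q 0 ^ 2 + q 1 ^ 2) ≤ ρ - 1 - 2 := by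
      have := lateral_radius_le_add_dist q p
      rw [hdist] at this
      linarith
    have h3 : q 0 ^ 2 + q 1 ^ 2 ≤ (ρ - 1 - 2) ^ 2 := lateral_sq_le_of_sqrt_le (by linarith) hlatq
    exact not_face_in_topBand hσ₂ L₂ s₂ A hneA₁ hneA₂ X P₂ R₀ h ρ hR₀ hρ hX hP₂X hP₂ hqX h1 h2 h3 (face_of_moving ver A hmv)

open scoped Classical in
/-- **Inner trackable balls of a FALLING family are carried by the launches the census counts.** -/
theorem card_trackable_inner_le_mul_card_launches_top (Tr : E3 → Prop)
    (hTr : ∀ q, Tr q → q ∈ X ∧ (IsFull X A q ∨ (∃ m, IsTwinReading X A m q ∧ ⟪A w, m⟫_ℝ = 0) ∨ (ver = WordVersion.v2 ∧ IsNarrow X A (A w) q)))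
    {lo hi : ℝ} (hXwin : ∀ q ∈ X, lo ≤ q 2 ∧ q 2 ≤ hi) (K : ℕ) (hK : hi - lo < K * |(A w) 2|)
    (R : Finset E3) (hR : ∀ p ∈ R, Tr p)
    (hRin : ∀ p ∈ R, -(R₀ + 1) < p 2 ∧ p 2 < h + (R₀ + 1) + 1 ∧
      Real.sqrt (p 0 ^ 2 + p 1 ^ 2) + (h + (R₀ + 1) + 2 - p 2) / |(A w) 2| ≤ ρ - 1 - 2) :
    R.card ≤ K * (X.filter fun b => Tr b ∧ ¬ Tr (b - A w) ∧
      (-(R₀ + 1) - 1 < (b + A w) 2 ∧ (b + A w) 2 < h + (R₀ + 1) + 1)).card := by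
  have hc1 : ‖A w‖ = 1 := by rw [LinearIsometryEquiv.norm_map, norm_eq_one_of_mem_fccSlots hw]
  have hc2ge : -1 ≤ (A w) 2 := by
    have := abs_sub_apply_le_dist' (A w) 0 2
    rw [PiLp.zero_apply, sub_zero, dist_zero_right, hc1] at this
    exact (abs_le.1 this).1
  refine card_trackable_le_mul_card_goodBottoms_of_ne Tr (fun b => -(R₀ + 1) - 1 < (b + A w) 2 ∧ (b + A w) 2 < h + (R₀ + 1) + 1) (A w)
    (fun q hq => (hTr q hq).1) hdown.ne hXwin K hK R hR ?_
  intro p hp k hchain _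
  obtain ⟨hp2, hp2', hlat⟩ := hRin p hp
  have hlt := chain_heights_lt_top ver hσ₂ L₂ s₂ A hneA₁ hneA₂ hw hdown X P₂ R₀ h ρ hR₀ hρ hX hP₂X hP₂ Tr hTr hp2' hlat hchain k le_rfl
  have e : (p - (k : ℝ) • A w + A w) 2 = (p - (k : ℝ) • A w) 2 + (A w) 2 := by rw [PiLp.add_apply]
  have e' : (p - (k : ℝ) • A w) 2 = p 2 - (k : ℝ) * (A w) 2 := by rw [PiLp.sub_apply, PiLp.smul_apply, smul_eq_mul]
  refine ⟨?_, by rw [e]; linarith⟩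
  rw [e, e']
  have : (k : ℝ) * (A w) 2 ≤ 0 := mul_nonpos_of_nonneg_of_nonpos (Nat.cast_nonneg _) hdown.le
  linarith

end CellTop

end Summit.Ventures.Crystal3D.Theorems

end
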